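import Literature.Computation.Certificates.PackedGramCertificate

/-!
# Packed Gram certificates, ROWS layout: big-denominator matrices and split data files

Compute-infrastructure file (cell certnum, seat certnum-sdp-3), the companion of
`PackedGramCertificate.lean` for the certificates real SOS producers emit. There the symmetric
integer matrix `A = den • Q` is ONE natural literal and every factor row is shipped as the three
base-`X` naturals `(p, r, t)`. Two facts about production certificates (gridfusion WSCC9 degree 4,
the `119 × 119` `V̇` block, 2026-08-26) make that layout too fat: the common denominator of the
exact Gram matrix has 167 bits (entries of `A` ≈ 175 bits ⇒ the single literal exceeds one file),
and the LDLᵀ weights `d_k` have ≈ 143 bits, so every Kronecker digit slot must be ≈ 220 bits wide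
although a factor digit carries ≈ 35 bits. This file keeps the kernel mechanism (GMP access,
Kronecker middle digits, one `decide`) and changes only the TRANSPORT:

* `A` is a LIST of row literals `Arows : List ℕ` (row `i` packed with `w` bits per entry, offset
  `2^(w−1)`): the list may be assembled from several data modules (`rows₁ ++ rows₂`), read by
  `rowEntry` (one GMP shift + `mod` on the row literal);
* factor row `i` (column `i` of `B`) is ONE compact natural `Crows[i]` with `v`-bit digits
  `B k i + O` (so the file carries ≈ `v` bits per factor entry, not a Kronecker slot);
* the kernel EXPANDS each compact row ONCE (`expandRow`: one peel pass producing the base-`X`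
  packings `(p, r, t)` of `PackedGramCertificate.lean`, digit bound included), then runs the same
  residual / diagonal-dominance pass (`resRowL`, `ddAllL`) and a list-walking symmetry pass
  (`symmRowL`, `symmAllL`, `O(n²)` row-literal reads, no random access into the list).

`checkRows n w den v x O Arows d Crows : Bool`. MEASURED (farm, ONE `decide +kernel` at default
heartbeats, 2026-08-27, dense synthetic certificates with the bit sizes of that production block:
182-bit entries of `A`, 113-bit weights, 33-bit factor digits): `n = m = 60` in 12.5 s wall
(241 KB file), `n = m = 84` in 25.7 s wall (469 KB file; ≈ 6 s of each is module loading), law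
≈ `n^3.3` at these operand sizes ⇒ ≈ 70 s projected for the `119` block (its data split over two
or three modules by size) — versus ≈ 166 s of kernel time plus ≈ 78 s of literal elaboration per
file over three files for the list-refined lane `PosSemidefIntList.lean` on the same block, and
versus the small-number regime of `PackedGramCertificate.lean` (15.5 s at `84`, 28.7 s at `120`).
SOUNDNESS is again a REDUCTION to
`PSD.IsGramCertZ` (`isGramCertZ_of_checkRows`) for the matrix `intMatrixRows n w Arows`, weights
`Packed.weights d` and the decoded factor `factorRows v O d Crows n`, whence
`quadForm_nonneg_of_checkRows`, `posSemidef_of_checkRows`, `isSymm_of_checkRows` and the SOS hook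
`SOS.GramSOS.quadNonneg_of_packedRows` (block matrix written as `toMatrixRows s w den Arows`).

## API (namespace `Literature.Computation.Certificates.PSD.Packed`)

* `rowEntry`, `intMatrixRows`, `toMatrixRows`; `expandRow`, `expandRows`, `resRowL`, `ddAllL`,
  `symmRowL`, `symmAllL`, `checkRows`; `factorRows`;
* `expandRow_spec`, `isGramCertZ_of_checkRows`, `isSymm_of_checkRows`,
  `quadForm_nonneg_of_checkRows`, `posSemidef_of_checkRows`, `SOS.GramSOS.quadNonneg_of_packedRows`;
* kernel-checked `example` (size 3) at the end; producer side: `sosgram/packed.py` (`pack_rows`).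

WHAT IS NOT CERTIFIED: as in `PackedGramCertificate.lean` — positive semidefiniteness of exactly
`toMatrixRows n w den Arows`; nothing about the floating-point objects the digits came from.

## References

* D. Harvey, *Faster polynomial multiplication via multipoint Kronecker substitution*, J. Symb.
  Comput. 44 (2009), §3.1 (packing / unpacking, coefficient bound). [Harvey2009]
* G. Blekherman, P. Parrilo, R. Thomas (eds.), *Semidefinite Optimization and Convex Algebraic
  Geometry*, SIAM 2012, App. A.1.2; Thm 3.39. [BlekhermanParriloThomas2012]
-/

namespace Literature.Computation.Certificates

namespace PSD

namespace Packed

open Finset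

/-! ### Data access -/

/-- Entry `j` of a packed row literal `Ri` (`w` bits per entry, offset `2^(w-1)`): one GMP shift and
one `mod`. [folklore] -/
def rowEntry (w Ri j : ℕ) : ℤ :=
  (((Ri >>> (w * j)) % 2 ^ w : ℕ) : ℤ) - ((2 ^ (w - 1) : ℕ) : ℤ)

/-- The integer matrix of a list of packed row literals (row `i` = `Arows[i]`, default `0`).
[folklore] -/
def intMatrixRows (n w : ℕ) (Arows : List ℕ) : Matrix (Fin n) (Fin n) ℤ :=
  fun i j => rowEntry w (Arows.getD i.val 0) j.val

/-- The RATIONAL presentation with common denominator `den`: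
`toMatrixRows n w den Arows i j = rowEntry w Arows[i] j / den`. [folklore] -/
def toMatrixRows (n w den : ℕ) (Arows : List ℕ) : Matrix (Fin n) (Fin n) ℚ :=
  fun i j => (rowEntry w (Arows.getD i.val 0) j.val : ℚ) / (den : ℚ)

/-! ### The checker -/

/-- Expand ONE compact factor row `c` (digit `k` = `c / V^k % V`, required `< Amax`) along the
weights: accumulates the base-`X` packings `p = p₀ + XP·Σ a_k X^k`, `r = r₀ X^m + Σ d_k a_k X^(m-1-k)`,
`t = t₀ + Σ d_k a_k`; `none` on a digit `≥ Amax` or digits beyond `|d|`. Kronecker packing.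
[cite: Harvey2009, §3.1] -/
def expandRow (V X Amax : ℕ) : List ℕ → ℕ → ℕ → ℕ → ℕ → ℕ → Option Row
  | dk :: ds, c, p, XP, r, t =>
      if c % V < Amax then
        expandRow V X Amax ds (c / V) (p + c % V * XP) (XP * X) (r * X + dk * (c % V)) (t + dk * (c % V))
      else none
  | [], c, p, _, r, t => if c = 0 then some ⟨p, r, t⟩ else none

/-- Expand all compact factor rows (fails if any row fails). [folklore] -/
def expandRows (V X Amax : ℕ) (d : List ℕ) : List ℕ → Option (List Row)
  | [] => some []
  | c :: cs =>
      match expandRow V X Amax d c 0 1 0 0, expandRows V X Amax d cs with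
      | some q, some qs => some (q :: qs)
      | _, _ => none

/-- Residual row `i` against the packed row literal `Ai`: `A_ij − Σ_k d_k B_ki B_kj`, `j = j₀, …`.
[folklore] -/
def resRowL (w X XM O D Ai : ℕ) (qi : Row) : ℕ → List Row → List ℤ
  | _, [] => []
  | j, qj :: qs => (rowEntry w Ai j - wdot X XM O D qi qj) :: resRowL w X XM O D Ai qi (j + 1) qs

/-- Diagonal dominance of all residual rows, walking the row literals and the expanded factor rows
together (row index `i`). [folklore] -/
def ddAllL (w X XM O D : ℕ) (P : List Row) : ℕ → List ℕ → List Row → Bool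
  | i, Ai :: As, qi :: qs => ddRowOK i (resRowL w X XM O D Ai qi 0 P) && ddAllL w X XM O D P (i + 1) As qs
  | _, [], [] => true
  | _, _, _ => false

/-- Symmetry of row `i` (literal `Ai`) against the rows `j = j₀, j₀+1, … < i` read from the head of
the row list: `A_ij = A_ji`. [folklore] -/
def symmRowL (w i Ai : ℕ) : List ℕ → ℕ → Bool
  | [], _ => true
  | Aj :: As, j => if j < i then (rowEntry w Ai j == rowEntry w Aj i) && symmRowL w i Ai As (j + 1) else true

/-- Symmetry of the whole matrix: every row against the rows before it. [folklore] -/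
def symmAllL (w : ℕ) (A : List ℕ) : ℕ → List ℕ → Bool
  | _, [] => true
  | i, Ai :: As => symmRowL w i Ai A 0 && symmAllL w A (i + 1) As

/-- **The packed Gram certificate check, rows layout**: `den > 0`; `n` row literals; `A`
symmetric; no-carry bound `m · max d · (2 O)² < 2^x`; every compact factor row expands (digits
`< 2 O`); residual `A − Bᵀ·diag d·B` diagonally dominant. Discharge by `decide +kernel`. [folklore] -/
def checkRows (n w den v x O : ℕ) (Arows : List ℕ) (d : List ℕ) (Crows : List ℕ) : Bool :=
  let X := 2 ^ x
  let m := d.length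
  decide (0 < den) && (Arows.length == n) && symmAllL w Arows 0 Arows &&
    decide (m * maxList d * (2 * O) ^ 2 < X) &&
    match expandRows (2 ^ v) X (2 * O) d Crows with
    | none => false
    | some P => (P.length == n) && ddAllL w X (X ^ (m - 1)) O (sumList d) P 0 Arows P

/-! ### Semantics of the expansion -/

/-- **Semantics of `expandRow`**: all `|ds|` compact digits are `< Amax`, `c < V^|ds|`, and the
returned packings are the accumulated Kronecker packings of the digits. [cite: Harvey2009, §3.1] -/
theorem expandRow_spec {V X Amax : ℕ} (hV : 0 < V) :
    ∀ (ds : List ℕ) (c p XP r t : ℕ) (q : Row), expandRow V X Amax ds c p XP r t = some q →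
      (∀ k < ds.length, dig V c k < Amax) ∧ c < V ^ ds.length ∧
      q.p = p + XP * ∑ k ∈ range ds.length, dig V c k * X ^ k ∧
      q.r = r * X ^ ds.length +
          ∑ k ∈ range ds.length, ds.getD k 0 * dig V c k * X ^ (ds.length - 1 - k) ∧
      q.t = t + ∑ k ∈ range ds.length, ds.getD k 0 * dig V c k
  | [], c, p, XP, r, t, q, h => by
      simp only [expandRow] at h
      split_ifs at h with hc
      simp only [Option.some.injEq] at h
      subst h; subst hc
      simp
  | dk :: ds, c, p, XP, r, t, q, h => by
      simp only [expandRow] at h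
      split_ifs at h with h0
      obtain ⟨hd, hc, hp, hr, ht⟩ := expandRow_spec hV ds (c / V) _ _ _ _ q h
      have hdig0 : dig V c 0 = c % V := by simp [dig]
      have hdigS : ∀ k, dig V c (k + 1) = dig V (c / V) k := fun k => by
        unfold dig; rw [pow_succ', ← Nat.div_div_eq_div_mul]
      refine ⟨?_, ?_, ?_, ?_, ?_⟩
      · intro k hk
        cases k with
        | zero => simpa [hdig0] using h0
        | succ k => rw [hdigS]; exact hd k (by simpa using hk)
      · rw [List.length_cons, pow_succ]
        exact (Nat.div_lt_iff_lt_mul hV).1 hc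
      · rw [hp, List.length_cons, Finset.sum_range_succ']
        simp only [hdigS, hdig0, pow_zero, mul_one]
        have h2 : ∑ k ∈ range ds.length, dig V (c / V) k * X ^ (k + 1) =
            X * ∑ k ∈ range ds.length, dig V (c / V) k * X ^ k := by
          rw [Finset.mul_sum]
          exact Finset.sum_congr rfl fun k _ => by rw [pow_succ]; ring
        rw [h2]
        ring
      · rw [hr, List.length_cons, Finset.sum_range_succ']
        simp only [List.getD_cons_succ, List.getD_cons_zero, hdigS, hdig0, Nat.add_sub_cancel,
          Nat.sub_zero]
        have h2 : ∀ k ∈ range ds.length,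
            ds.getD k 0 * dig V (c / V) k * X ^ (ds.length - (k + 1)) =
              ds.getD k 0 * dig V (c / V) k * X ^ (ds.length - 1 - k) := by
          intro k _
          congr 2
          omega
        rw [Finset.sum_congr rfl h2, pow_succ]
        ring
      · rw [ht, List.length_cons, Finset.sum_range_succ']
        simp only [List.getD_cons_succ, List.getD_cons_zero, hdigS, hdig0]
        ring

/-- Semantics of `expandRows`: same length, and row `i` of the result is the expansion of compact
row `i`. [folklore] -/
private theorem expandRows_spec {V X Amax : ℕ} (d : List ℕ) :
    ∀ (C : List ℕ) (P : List Row), expandRows V X Amax d C = some P →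
      P.length = C.length ∧
      ∀ i < C.length, expandRow V X Amax d (C.getD i 0) 0 1 0 0 = some (P.getD i ⟨0, 0, 0⟩)
  | [], P, h => by
      simp only [expandRows, Option.some.injEq] at h
      subst h
      simp
  | c :: cs, P, h => by
      simp only [expandRows] at h
      split at h
      · rename_i q qs hq hqs
        simp only [Option.some.injEq] at h
        subst h
        obtain ⟨hl, hi⟩ := expandRows_spec d cs qs hqs
        refine ⟨by simp [hl], fun i hi' => ?_⟩
        cases i with
        | zero => simpa using hq
        | succ i => simpa using hi i (by simpa using hi')
      · simp at h

/-! ### List bookkeeping -/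

/-- `absSum` is the sum of the absolute values of the entries. [folklore] -/
private theorem absSum_eq' : ∀ l : List ℤ, absSum l = ∑ k ∈ range l.length, ((l.getD k 0).natAbs : ℤ)
  | [] => by simp [absSum]
  | a :: as => by
      rw [absSum, absSum_eq' as, List.length_cons, Finset.sum_range_succ']
      simp [add_comm]

/-- `maxList` bounds every entry. [folklore] -/
private theorem getD_le_maxList' : ∀ (l : List ℕ) (k : ℕ), l.getD k 0 ≤ maxList l
  | [], k => by simp [maxList]
  | a :: as, 0 => by simp [maxList, List.foldr]
  | a :: as, k + 1 => by
      simp only [List.getD_cons_succ, maxList, List.foldr_cons]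
      exact le_trans (getD_le_maxList' as k) (le_max_right _ _)

/-- `sumList` is the sum of the entries. [folklore] -/
private theorem sumList_eq' : ∀ l : List ℕ, sumList l = ∑ k ∈ range l.length, l.getD k 0
  | [] => by simp [sumList]
  | a :: as => by
      have ih := sumList_eq' as
      simp only [sumList, List.foldr_cons] at ih ⊢
      rw [ih, List.length_cons, Finset.sum_range_succ']
      simp [add_comm]

/-- Length of a residual row. [folklore] -/
private theorem length_resRowL (w X XM O D Ai : ℕ) (qi : Row) :
    ∀ (j : ℕ) (qs : List Row), (resRowL w X XM O D Ai qi j qs).length = qs.length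
  | _, [] => rfl
  | j, _ :: qs => by simp [resRowL, length_resRowL w X XM O D Ai qi (j + 1) qs]

/-- Entries of a residual row. [folklore] -/
private theorem getD_resRowL (w X XM O D Ai : ℕ) (qi : Row) :
    ∀ (j : ℕ) (qs : List Row) (k : ℕ), k < qs.length →
      (resRowL w X XM O D Ai qi j qs).getD k 0 = rowEntry w Ai (j + k) - wdot X XM O D qi (qs.getD k ⟨0, 0, 0⟩)
  | _, [], k, hk => by simp at hk
  | j, qj :: qs, 0, _ => by simp [resRowL]
  | j, qj :: qs, k + 1, hk => by
      simp only [resRowL, List.getD_cons_succ]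
      rw [getD_resRowL w X XM O D Ai qi (j + 1) qs k (by simpa using hk)]
      simp only [add_assoc, add_comm 1 k]

/-- Semantics of `ddAllL`: the two lists have the same length and every row passes. [folklore] -/
private theorem ddAllL_spec (w X XM O D : ℕ) (P : List Row) :
    ∀ (i₀ : ℕ) (As : List ℕ) (qs : List Row), ddAllL w X XM O D P i₀ As qs = true →
      As.length = qs.length ∧
      ∀ k < qs.length, ddRowOK (i₀ + k) (resRowL w X XM O D (As.getD k 0) (qs.getD k ⟨0, 0, 0⟩) 0 P) = true
  | _, [], [], _ => by simp
  | _, [], _ :: _, h => by simp [ddAllL] at h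
  | _, _ :: _, [], h => by simp [ddAllL] at h
  | i₀, Ai :: As, qi :: qs, h => by
      simp only [ddAllL, Bool.and_eq_true] at h
      obtain ⟨hl, hk⟩ := ddAllL_spec w X XM O D P (i₀ + 1) As qs h.2
      refine ⟨by simp [hl], fun k hk' => ?_⟩
      cases k with
      | zero => simpa using h.1
      | succ k =>
          have := hk k (by simpa using hk')
          simpa [add_assoc, add_comm 1 k] using this

/-- Semantics of `symmRowL`. [folklore] -/
private theorem symmRowL_spec (w i Ai : ℕ) :
    ∀ (L : List ℕ) (j₀ : ℕ), symmRowL w i Ai L j₀ = true →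
      ∀ k < L.length, j₀ + k < i → rowEntry w Ai (j₀ + k) = rowEntry w (L.getD k 0) i
  | [], _, _, k, hk, _ => by simp at hk
  | Aj :: As, j₀, h, k, hk, hki => by
      simp only [symmRowL] at h
      have hj : j₀ < i := by omega
      rw [if_pos hj] at h
      simp only [Bool.and_eq_true, beq_iff_eq] at h
      cases k with
      | zero => simpa using h.1
      | succ k =>
          have := symmRowL_spec w i Ai As (j₀ + 1) h.2 k (by simpa using hk) (by omega)
          simpa [add_assoc, add_comm 1 k] using this

/-- Semantics of `symmAllL`. [folklore] -/
private theorem symmAllL_spec (w : ℕ) (A : List ℕ) :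
    ∀ (i₀ : ℕ) (As : List ℕ), symmAllL w A i₀ As = true →
      ∀ k < As.length, symmRowL w (i₀ + k) (As.getD k 0) A 0 = true
  | _, [], _, k, hk => by simp at hk
  | i₀, Ai :: As, h, k, hk => by
      simp only [symmAllL, Bool.and_eq_true] at h
      cases k with
      | zero => simpa using h.1
      | succ k =>
          have := symmAllL_spec w A (i₀ + 1) As h.2 k (by simpa using hk)
          simpa [add_assoc, add_comm 1 k] using this

/-! ### Soundness -/

/-- The decoded factor of the rows layout: `B k i = (digit k of Crows[i], base 2^v) − O`.
[folklore] -/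
def factorRows (v O : ℕ) (d : List ℕ) (Crows : List ℕ) (n : ℕ) : Matrix (Fin d.length) (Fin n) ℤ :=
  fun k i => ((dig (2 ^ v) (Crows.getD i.val 0) k.val : ℕ) : ℤ) - (O : ℤ)

/-- The dot-product identity behind `wdot` for two EXPANDED rows: the middle digit of `p_i · r_j`
minus the offset terms is `Σ_k d_k (a_ik − O)(a_jk − O)`. [cite: Harvey2009, §3.1] -/
private theorem wdot_expand_eq {V x O : ℕ} (hV : 0 < V) {d : List ℕ} {ci cj : ℕ} {qi qj : Row}
    (hi : expandRow V (2 ^ x) (2 * O) d ci 0 1 0 0 = some qi)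
    (hj : expandRow V (2 ^ x) (2 * O) d cj 0 1 0 0 = some qj)
    (hbound : d.length * maxList d * (2 * O) ^ 2 < 2 ^ x) :
    wdot (2 ^ x) ((2 ^ x) ^ (d.length - 1)) O (sumList d) qi qj =
      ∑ k ∈ range d.length, (d.getD k 0 : ℤ) *
        ((((dig V ci k : ℕ) : ℤ) - O) * (((dig V cj k : ℕ) : ℤ) - O)) := by
  have hX : 0 < 2 ^ x := Nat.two_pow_pos x
  set X := 2 ^ x with hXdef
  obtain ⟨hdi, _, hpi, _, hti⟩ := expandRow_spec hV d ci 0 1 0 0 qi hi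
  obtain ⟨hdj, _, _, hrj, htj⟩ := expandRow_spec hV d cj 0 1 0 0 qj hj
  simp only [zero_add, one_mul, zero_mul] at hpi hrj hti htj
  have hmid : midDigit X (X ^ (d.length - 1)) (qi.p * qj.r) =
      ∑ k ∈ range d.length, dig V ci k * (d.getD k 0 * dig V cj k) := by
    have key := middleDigit_eq hX (fun k => dig V ci k) (fun l => d.getD l 0 * dig V cj l)
      (m := d.length) (amax := 2 * O - 1) (bmax := maxList d * (2 * O - 1)) ?_ ?_ ?_
    · rw [← hpi, ← hrj] at key
      exact key
    · intro k hk; have := hdi k hk; omega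
    · intro l hl
      exact Nat.mul_le_mul (getD_le_maxList' d l) (by have := hdj l hl; omega)
    · calc d.length * (2 * O - 1) * (maxList d * (2 * O - 1))
          = d.length * maxList d * ((2 * O - 1) * (2 * O - 1)) := by ring
        _ ≤ d.length * maxList d * (2 * O) ^ 2 := by
            apply Nat.mul_le_mul_left
            rw [sq]
            exact Nat.mul_le_mul (Nat.sub_le _ _) (Nat.sub_le _ _)
        _ < X := hbound
  unfold wdot
  rw [hmid, hti, htj, sumList_eq' d]
  push_cast
  simp only [mul_add, Finset.mul_sum, ← Finset.sum_add_distrib, ← Finset.sum_sub_distrib]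
  exact Finset.sum_congr rfl fun k _ => by ring

/-- **Soundness (reduction), rows layout**: a passing `checkRows` is an integer rounded Gram
certificate `PSD.IsGramCertZ` for the row-literal matrix, the weights and the decoded compact
factor. [cite: BlekhermanParriloThomas2012, App. A.1.2] -/
theorem isGramCertZ_of_checkRows {n w den v x O : ℕ} {Arows d Crows : List ℕ}
    (h : checkRows n w den v x O Arows d Crows = true) :
    IsGramCertZ (intMatrixRows n w Arows) (weights d) (factorRows v O d Crows n) := by
  have hV : 0 < 2 ^ v := Nat.two_pow_pos v
  simp only [checkRows, Bool.and_eq_true, decide_eq_true_eq, beq_iff_eq] at h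
  obtain ⟨⟨⟨⟨_, hlen⟩, hsym⟩, hbound⟩, hexp⟩ := h
  split at hexp
  · simp at hexp
  · rename_i P hP
    simp only [Bool.and_eq_true, beq_iff_eq] at hexp
    obtain ⟨hPlen, hdd⟩ := hexp
    obtain ⟨hPC, hrows⟩ := expandRows_spec d Crows P hP
    obtain ⟨hAP, hddk⟩ := ddAllL_spec w (2 ^ x) ((2 ^ x) ^ (d.length - 1)) O (sumList d) P 0 Arows P hdd
    have hCn : Crows.length = n := by omega
    have hexp' : ∀ i < n, expandRow (2 ^ v) (2 ^ x) (2 * O) d (Crows.getD i 0) 0 1 0 0 =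
        some (P.getD i ⟨0, 0, 0⟩) := fun i hi => hrows i (by omega)
    -- the residual entries
    have hres : ∀ i j : Fin n,
        gramResidualZ (intMatrixRows n w Arows) (weights d) (factorRows v O d Crows n) i j =
          rowEntry w (Arows.getD i.val 0) j.val -
            wdot (2 ^ x) ((2 ^ x) ^ (d.length - 1)) O (sumList d) (P.getD i.val ⟨0, 0, 0⟩)
              (P.getD j.val ⟨0, 0, 0⟩) := by
      intro i j
      rw [wdot_expand_eq hV (hexp' i i.isLt) (hexp' j j.isLt) hbound, Finset.sum_range]
      rfl
    refine IsDiagDominantZ.intro (fun i j => ?_) (fun i => ?_)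
    · -- symmetry
      simp only [gramResidualZ, intMatrixRows]
      have hA : rowEntry w (Arows.getD i.val 0) j.val = rowEntry w (Arows.getD j.val 0) i.val := by
        rcases lt_trichotomy i.val j.val with hij | hij | hij
        · have h1 := symmAllL_spec w Arows 0 Arows hsym j.val (by omega)
          simp only [zero_add] at h1
          have h2 := symmRowL_spec w j.val (Arows.getD j.val 0) Arows 0 h1 i.val (by omega) (by omega)
          simp only [zero_add] at h2
          exact h2.symm
        · rw [hij]
        · have h1 := symmAllL_spec w Arows 0 Arows hsym i.val (by omega)
          simp only [zero_add] at h1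
          have h2 := symmRowL_spec w i.val (Arows.getD i.val 0) Arows 0 h1 j.val (by omega) (by omega)
          simp only [zero_add] at h2
          exact h2
      rw [hA]
      congr 1
      exact Finset.sum_congr rfl fun k _ => by ring
    · -- row `i` diagonal dominance
      set M := gramResidualZ (intMatrixRows n w Arows) (weights d) (factorRows v O d Crows n) with hM
      set row := resRowL w (2 ^ x) ((2 ^ x) ^ (d.length - 1)) O (sumList d) (Arows.getD i.val 0)
        (P.getD i.val ⟨0, 0, 0⟩) 0 P with hrowdef
      have hrow := hddk i.val (by omega)
      simp only [zero_add] at hrow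
      change ddRowOK i.val row = true at hrow
      simp only [ddRowOK, decide_eq_true_eq, absSum_eq'] at hrow
      have hlenrow : row.length = n := by rw [hrowdef, length_resRowL, hPlen]
      rw [hlenrow] at hrow
      have hf : ∀ (k : ℕ) (hk : k < n), row.getD k 0 = M i ⟨k, hk⟩ := by
        intro k hk
        rw [hrowdef, getD_resRowL _ _ _ _ _ _ _ _ _ k (by rw [hPlen]; exact hk), hres, zero_add]
      have h1 : ∑ j : Fin n, |M i j| = ∑ k ∈ range n, ((row.getD k 0).natAbs : ℤ) := by
        rw [Finset.sum_range (fun k => ((row.getD k 0).natAbs : ℤ))]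
        exact Finset.sum_congr rfl fun j _ => by rw [hf j.val j.isLt, Int.natCast_natAbs]
      rw [Finset.sum_erase_eq_sub (Finset.mem_univ i), h1, ← Int.natCast_natAbs (M i i),
        ← hf i.val i.isLt]
      exact hrow

/-- `den > 0` for a passing rows check. [folklore] -/
private theorem den_pos_of_checkRows {n w den v x O : ℕ} {Arows d Crows : List ℕ}
    (h : checkRows n w den v x O Arows d Crows = true) : 0 < den := by
  simp only [checkRows, Bool.and_eq_true, decide_eq_true_eq] at h
  exact h.1.1.1.1

/-- The integer matrix is `den •` the rational presentation, entrywise. [folklore] -/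
private theorem intMatrixRows_cast_eq {n w den : ℕ} {Arows : List ℕ} (hden : 0 < den) (i j : Fin n) :
    (intMatrixRows n w Arows i j : ℚ) = (den : ℚ) * toMatrixRows n w den Arows i j := by
  have hd : (den : ℚ) ≠ 0 := by exact_mod_cast hden.ne'
  simp only [intMatrixRows, toMatrixRows]
  field_simp

/-- **The row-literal matrix of a passing check is symmetric.**
[cite: BlekhermanParriloThomas2012, App. A.1.2] -/
theorem isSymm_of_checkRows {n w den v x O : ℕ} {Arows d Crows : List ℕ}
    (h : checkRows n w den v x O Arows d Crows = true) : (toMatrixRows n w den Arows).IsSymm := by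
  have hs := (isGramCertZ_of_checkRows h).isSymm
  refine Matrix.IsSymm.ext fun i j => ?_
  have hij : intMatrixRows n w Arows j i = intMatrixRows n w Arows i j := hs.apply i j
  simp only [intMatrixRows] at hij
  simp only [toMatrixRows, hij]

/-- **Soundness (quadratic form), rows layout.** [cite: BlekhermanParriloThomas2012, App. A.1.2] -/
theorem quadForm_nonneg_of_checkRows {R' : Type*} [Field R'] [LinearOrder R']
    [IsStrictOrderedRing R'] {n w den v x O : ℕ} {Arows d Crows : List ℕ}
    (h : checkRows n w den v x O Arows d Crows = true) (y : Fin n → R') :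
    0 ≤ ∑ i, ∑ j, y i * (toMatrixRows n w den Arows i j : R') * y j :=
  (isGramCertZ_of_checkRows h).quadForm_nonneg_of_smul (by exact_mod_cast den_pos_of_checkRows h)
    (intMatrixRows_cast_eq (den_pos_of_checkRows h)) y

/-- **Soundness (`Matrix.PosSemidef`), rows layout**, over a linearly ordered field with trivial
star (e.g. `ℝ`). [cite: BlekhermanParriloThomas2012, App. A.1.2] -/
theorem posSemidef_of_checkRows {R' : Type*} [Field R'] [LinearOrder R'] [IsStrictOrderedRing R']
    [StarRing R'] [TrivialStar R'] {n w den v x O : ℕ} {Arows d Crows : List ℕ}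
    (h : checkRows n w den v x O Arows d Crows = true) :
    ((toMatrixRows n w den Arows).map (Rat.cast : ℚ → R')).PosSemidef :=
  (isGramCertZ_of_checkRows h).posSemidef_of_smul (by exact_mod_cast den_pos_of_checkRows h)
    (intMatrixRows_cast_eq (den_pos_of_checkRows h))

end Packed

end PSD

/-! ### The SOS hook, rows layout -/

namespace SOS.GramSOS

/-- **Packed rows certificate ⇒ `QuadNonneg`**: a Gram block whose matrix is WRITTEN as
`PSD.Packed.toMatrixRows g.s w den Arows` and whose rows check passes has nonnegative quadratic
form (the hypothesis of `nonneg_of_quadGR` / `nonneg_of_quadG`).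
[cite: BlekhermanParriloThomas2012, Thm 3.39] -/
theorem quadNonneg_of_packedRows {R' : Type*} [Field R'] [LinearOrder R'] [IsStrictOrderedRing R']
    (g : GramSOS) {w den v x O : ℕ} {Arows d Crows : List ℕ}
    (hQ : g.Q = PSD.Packed.toMatrixRows g.s w den Arows)
    (h : PSD.Packed.checkRows g.s w den v x O Arows d Crows = true) : g.QuadNonneg R' :=
  quadNonneg_of_gramCertZ g (PSD.Packed.isGramCertZ_of_checkRows h)
    (c := (den : ℚ)) (by exact_mod_cast PSD.Packed.den_pos_of_checkRows h)
    fun i j => by rw [hQ]; exact PSD.Packed.intMatrixRows_cast_eq (PSD.Packed.den_pos_of_checkRows h) i j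

end SOS.GramSOS

/-! ### Tests / usage templates (kernel-checked) -/

namespace PSD.Packed

/-- Test data: rows of the path-graph matrix `[[2,-1,0],[-1,2,-1],[0,-1,2]]`, `4` bits per entry
(offset `8`), denominator `1` — split over two "data modules" to show the `++` assembly. [folklore] -/
private def testRows_A₁ : List ℕ :=
  [2170, 1959]

/-- Test data: the last row. [folklore] -/
private def testRows_A₂ : List ℕ :=
  [2680]

/-- Test data: unit weights. [folklore] -/
private def testRows_d : List ℕ :=
  [1, 1, 1]

/-- Test data: compact columns of the factor `B = [[1,-1,0],[0,1,-1],[0,0,1]]` (`3`-bit digits,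
offset `2`). [folklore] -/
private def testRows_C : List ℕ :=
  [147, 153, 202]

/-- Test: the rows check passes in the kernel … -/
example : checkRows 3 4 1 3 7 2 (testRows_A₁ ++ testRows_A₂) testRows_d testRows_C = true := by
  decide +kernel

/-- … hence the presented rational matrix is positive semidefinite over `ℝ`. -/
example : ((toMatrixRows 3 4 1 (testRows_A₁ ++ testRows_A₂)).map (Rat.cast : ℚ → ℝ)).PosSemidef :=
  posSemidef_of_checkRows (v := 3) (x := 7) (O := 2) (d := testRows_d) (Crows := testRows_C)
    (by decide +kernel)

/-- Test: the presentation decodes to the intended matrix (entry `(1,0) = -1`, `(2,2) = 2`). -/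
example : toMatrixRows 3 4 1 (testRows_A₁ ++ testRows_A₂) 1 0 = -1 ∧
    toMatrixRows 3 4 1 (testRows_A₁ ++ testRows_A₂) 2 2 = 2 := by
  constructor <;> decide +kernel

end PSD.Packed

/-! ### Row-range split of the rows check (APPEND 2026-08-27, certnum-sdp-3; gridfusion K-STREAM G2)

One `checkRows` decide grows like `n^≈3.3`; at `n = 396` with 53-bit rows it sits at the client's
per-file budget. The split below keeps the certificate format and the conclusion
(`IsGramCertZ (intMatrixRows n w Arows) (weights d) (factorRows v O d Crows n)`) and cuts the WORK:
`checkRowsHead` = every check except the diagonal-dominance walk (one cheap file), and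
`checkRowsRange … lo cnt` = diagonal dominance of the residual rows `lo … lo+cnt−1` only (each range
its own file; every range re-expands the compact factor rows, an `O(n·m)` peel). `RangesOK` lists the
range facts; `isGramCertZ_of_checkRowsRanges` assembles them. -/

namespace PSD.Packed

open Finset

/-- Diagonal dominance of the residual rows `i, i+1, …` (fuel `k`), rows read BY INDEX from the row
literals and the expanded factor rows. [cite: BlekhermanParriloThomas2012, App. A.1.2] -/
def ddRangeL (w X XM O D : ℕ) (P : List Row) (Arows : List ℕ) : ℕ → ℕ → Bool
  | 0, _ => true
  | k + 1, i => ddRowOK i (resRowL w X XM O D (Arows.getD i 0) (P.getD i ⟨0, 0, 0⟩) 0 P) &&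
      ddRangeL w X XM O D P Arows k (i + 1)

/-- **Head of the rows check**: `den > 0`, `n` row literals, symmetry, the no-carry bound, and every
compact factor row expands (with `n` rows) — everything of `checkRows` except the diagonal-dominance
walk. [cite: BlekhermanParriloThomas2012, App. A.1.2] -/
def checkRowsHead (n w den v x O : ℕ) (Arows d Crows : List ℕ) : Bool :=
  let X := 2 ^ x
  let m := d.length
  decide (0 < den) && (Arows.length == n) && symmAllL w Arows 0 Arows &&
    decide (m * maxList d * (2 * O) ^ 2 < X) &&
    match expandRows (2 ^ v) X (2 * O) d Crows with
    | none => false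
    | some P => P.length == n

/-- **One range of the rows check**: the residual rows `lo … lo+cnt−1` are diagonally dominant
(the factor rows are expanded inside this file too). [cite: BlekhermanParriloThomas2012, App. A.1.2] -/
def checkRowsRange (w v x O : ℕ) (Arows d Crows : List ℕ) (lo cnt : ℕ) : Bool :=
  let X := 2 ^ x
  let m := d.length
  match expandRows (2 ^ v) X (2 * O) d Crows with
  | none => false
  | some P => ddRangeL w X (X ^ (m - 1)) O (sumList d) P Arows cnt lo

/-- **Range facts covering consecutive rows from `lo`**: `RangesOK … lo [c₀, c₁, …]` says
`checkRowsRange … lo c₀ = true ∧ checkRowsRange … (lo + c₀) c₁ = true ∧ …` — one `decide +kernel`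
per range file, assembled by `⟨h₀, h₁, …, trivial⟩`. [cite: BlekhermanParriloThomas2012, App. A.1.2] -/
def RangesOK (w v x O : ℕ) (Arows d Crows : List ℕ) : ℕ → List ℕ → Prop
  | _, [] => True
  | lo, cnt :: rest => checkRowsRange w v x O Arows d Crows lo cnt = true ∧
      RangesOK w v x O Arows d Crows (lo + cnt) rest

/-- Semantics of `ddRangeL`. [folklore] -/
private theorem ddRangeL_spec (w X XM O D : ℕ) (P : List Row) (Arows : List ℕ) :
    ∀ (k i₀ : ℕ), ddRangeL w X XM O D P Arows k i₀ = true →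
      ∀ i, i₀ ≤ i → i < i₀ + k →
        ddRowOK i (resRowL w X XM O D (Arows.getD i 0) (P.getD i ⟨0, 0, 0⟩) 0 P) = true
  | 0, _, _, i, h1, h2 => by omega
  | k + 1, i₀, h, i, h1, h2 => by
    rw [ddRangeL, Bool.and_eq_true] at h
    by_cases hi : i = i₀
    · subst hi; exact h.1
    · exact ddRangeL_spec w X XM O D P Arows k (i₀ + 1) h.2 i (by omega) (by omega)

/-- Semantics of `RangesOK`: every row index below `lo + Σ cnts` (from `lo` on) has a diagonally
dominant residual row, for THE expansion `P` of the factor rows. [folklore] -/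
private theorem rangesOK_spec (w v x O : ℕ) (Arows d Crows : List ℕ) {P : List Row}
    (hP : expandRows (2 ^ v) (2 ^ x) (2 * O) d Crows = some P) :
    ∀ (cnts : List ℕ) (lo : ℕ), RangesOK w v x O Arows d Crows lo cnts →
      ∀ i, lo ≤ i → i < lo + cnts.sum →
        ddRowOK i (resRowL w (2 ^ x) ((2 ^ x) ^ (d.length - 1)) O (sumList d) (Arows.getD i 0)
          (P.getD i ⟨0, 0, 0⟩) 0 P) = true
  | [], lo, _, i, h1, h2 => by simp at h2; omega
  | cnt :: rest, lo, h, i, h1, h2 => by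
    obtain ⟨hr, hrest⟩ := h
    by_cases hi : i < lo + cnt
    · have hr' : ddRangeL w (2 ^ x) ((2 ^ x) ^ (d.length - 1)) O (sumList d) P Arows cnt lo = true := by
        simp only [checkRowsRange, hP] at hr
        exact hr
      exact ddRangeL_spec _ _ _ _ _ P Arows cnt lo hr' i h1 hi
    · rw [List.sum_cons] at h2
      exact rangesOK_spec w v x O Arows d Crows hP rest (lo + cnt) hrest i (by omega) (by omega)

/-- **Soundness of the SPLIT rows check**: the head check plus range facts covering all `n` rows give
the integer rounded Gram certificate — the same conclusion as `isGramCertZ_of_checkRows`.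
[cite: BlekhermanParriloThomas2012, App. A.1.2] -/
theorem isGramCertZ_of_checkRowsRanges {n w den v x O : ℕ} {Arows d Crows : List ℕ} {cnts : List ℕ}
    (hhead : checkRowsHead n w den v x O Arows d Crows = true)
    (hranges : RangesOK w v x O Arows d Crows 0 cnts) (hcov : n ≤ cnts.sum) :
    IsGramCertZ (intMatrixRows n w Arows) (weights d) (factorRows v O d Crows n) := by
  have hV : 0 < 2 ^ v := Nat.two_pow_pos v
  simp only [checkRowsHead, Bool.and_eq_true, decide_eq_true_eq, beq_iff_eq] at hhead
  obtain ⟨⟨⟨⟨_, hlen⟩, hsym⟩, hbound⟩, hexp⟩ := hhead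
  split at hexp
  · simp at hexp
  · rename_i P hP
    have hPlen : P.length = n := by simpa using hexp
    obtain ⟨hPC, hrows⟩ := expandRows_spec d Crows P hP
    have hddk := rangesOK_spec w v x O Arows d Crows hP cnts 0 hranges
    have hCn : Crows.length = n := by omega
    have hexp' : ∀ i < n, expandRow (2 ^ v) (2 ^ x) (2 * O) d (Crows.getD i 0) 0 1 0 0 =
        some (P.getD i ⟨0, 0, 0⟩) := fun i hi => hrows i (by omega)
    have hres : ∀ i j : Fin n,
        gramResidualZ (intMatrixRows n w Arows) (weights d) (factorRows v O d Crows n) i j =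
          rowEntry w (Arows.getD i.val 0) j.val -
            wdot (2 ^ x) ((2 ^ x) ^ (d.length - 1)) O (sumList d) (P.getD i.val ⟨0, 0, 0⟩)
              (P.getD j.val ⟨0, 0, 0⟩) := by
      intro i j
      rw [wdot_expand_eq hV (hexp' i i.isLt) (hexp' j j.isLt) hbound, Finset.sum_range]
      rfl
    refine IsDiagDominantZ.intro (fun i j => ?_) (fun i => ?_)
    · simp only [gramResidualZ, intMatrixRows]
      have hA : rowEntry w (Arows.getD i.val 0) j.val = rowEntry w (Arows.getD j.val 0) i.val := by
        rcases lt_trichotomy i.val j.val with hij | hij | hij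
        · have h1 := symmAllL_spec w Arows 0 Arows hsym j.val (by omega)
          simp only [zero_add] at h1
          have h2 := symmRowL_spec w j.val (Arows.getD j.val 0) Arows 0 h1 i.val (by omega) (by omega)
          simp only [zero_add] at h2
          exact h2.symm
        · rw [hij]
        · have h1 := symmAllL_spec w Arows 0 Arows hsym i.val (by omega)
          simp only [zero_add] at h1
          have h2 := symmRowL_spec w i.val (Arows.getD i.val 0) Arows 0 h1 j.val (by omega) (by omega)
          simp only [zero_add] at h2
          exact h2
      rw [hA]
      congr 1
      exact Finset.sum_congr rfl fun k _ => by ring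
    · set M := gramResidualZ (intMatrixRows n w Arows) (weights d) (factorRows v O d Crows n) with hM
      set row := resRowL w (2 ^ x) ((2 ^ x) ^ (d.length - 1)) O (sumList d) (Arows.getD i.val 0)
        (P.getD i.val ⟨0, 0, 0⟩) 0 P with hrowdef
      have hrow := hddk i.val (Nat.zero_le _) (by omega)
      change ddRowOK i.val row = true at hrow
      simp only [ddRowOK, decide_eq_true_eq, absSum_eq'] at hrow
      have hlenrow : row.length = n := by rw [hrowdef, length_resRowL, hPlen]
      rw [hlenrow] at hrow
      have hf : ∀ (k : ℕ) (hk : k < n), row.getD k 0 = M i ⟨k, hk⟩ := by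
        intro k hk
        rw [hrowdef, getD_resRowL _ _ _ _ _ _ _ _ _ k (by rw [hPlen]; exact hk), hres, zero_add]
      have h1 : ∑ j : Fin n, |M i j| = ∑ k ∈ range n, ((row.getD k 0).natAbs : ℤ) := by
        rw [Finset.sum_range (fun k => ((row.getD k 0).natAbs : ℤ))]
        exact Finset.sum_congr rfl fun j _ => by rw [hf j.val j.isLt, Int.natCast_natAbs]
      rw [Finset.sum_erase_eq_sub (Finset.mem_univ i), h1, ← Int.natCast_natAbs (M i i),
        ← hf i.val i.isLt]
      exact hrow

/-- Test: the split check on the `3 × 3` example, two ranges `[0,2) ∪ [2,3)`, kernel. [folklore] -/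
example : IsGramCertZ (intMatrixRows 3 4 (testRows_A₁ ++ testRows_A₂)) (weights testRows_d)
    (factorRows 3 2 testRows_d testRows_C 3) :=
  isGramCertZ_of_checkRowsRanges (den := 1) (x := 7) (cnts := [2, 1]) (by decide +kernel)
    ⟨by decide +kernel, by decide +kernel, trivial⟩ (by norm_num)

end PSD.Packed

end Literature.Computation.Certificates
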